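import Literature.Computability.AlgebraicComplexity.GlobalStageAssembly
import Literature.Computability.AlgebraicComplexity.LaserMethodTypeCount
import HarnessLib

/-!
# `p_comp` is well defined and Claim 5.14 as an exact double count
(Vassilevska Williams–Xu–Xu–Zhou 2024, Def. 5.13 and Claim 5.14) — proved

Topic `Literature/Computability/AlgebraicComplexity`.  §5.6 of Vassilevska Williams–Xu–Xu–Zhou
(SODA 2024, arXiv:2307.07970):

> **Definition 5.13 (`p_comp`).** For fixed `Z_K̂` and `Z_K` where `Z_K̂ ∈ Z_K` and `Z_K̂` is typical,
> `p_comp` is the probability that a uniformly random block triple `X_I Y_J Z_K` consistent with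
> `α` is compatible with `K̂`.  By symmetry, this probability is the same for different `Z_K̂` and
> `Z_K` …, so `p_comp` is well-defined.
> **Claim 5.14** [proof]: "By symmetry, it suffices to compute the following two quantities, and
> `p_comp` will be the ratio between them: (1) the number of tuples `(I, J, K, K̂)` where `X_I Y_J Z_K`
> is consistent with `α`, `K̂ ∈ K`, `Z_K̂` is typical, and `Z_K̂` is compatible with `X_I Y_J Z_K`;
> (2) the number of `(I, J, K, K̂)` where `X_I Y_J Z_K` is consistent with `α`, `K̂ ∈ K`, and
> `Z_K̂` is typical."

This file PROVES the two "by symmetry" steps and the resulting exact identity, for the data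
`D : GlobalStageData c n M` of one region (`GlobalStageStructure.lean`) whose set `𝒯α` of
`α`-consistent triples is stable and transitive under the symmetric group `S_n` permuting the
positions (as is the set of ALL triples of a joint type, `jointTypeClass`, see
`perm_mem_jointTypeClass`, `exists_perm_of_mem_jointTypeClass`):

* equivariance of position classes, complete split distributions, usefulness, typicalness and
  compatibility under `S_n` (`completeSplitOn_comp`, `isCompatibleWith_comp_iff`, …);
* `compatCount_eq_of_mem` — the number `C` of level-1 `Z`-blocks compatible with a triple of `𝒯α`
  does not depend on the triple;
* `letterCount_pairSeq_of_isTypical` — a typical pair `(K, K̂)` has a determined joint type, so any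
  two typical pairs differ by a permutation; hence (`card_compatTriples_eq_of_mem`) **the number `V`
  of triples of `𝒯α` through `Z_K` compatible with a typical `K̂ ∈ Z_K` does not depend on `(K, K̂)`**
  — Def. 5.13 is well posed (`p_comp = V · numzblock / numalpha`);
* `vxxz2024_claim514_count` — **the double count**: `V · #{typical pairs} = |𝒯α| · C`
  (both sides count the pairs (triple of `𝒯α`, compatible `K̂` in its `Z`-block); the printed
  "`p_comp` is the ratio between (1) and (2)"), with `#{typical pairs} = |typeClass n θ|` for the
  joint type `θ` of any typical pair (`card_typicalPairs_eq`);
* `card_holePairs_le` — consequently the hole count `U(T)` of `GlobalStageHoles.lean` is at most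
  `M_Z(T) · V` ("the total number of level-`ℓ` block triples `X_{I'} Y_{J'} Z_K` that is compatible
  with `Z_K̂` is `(numalpha/numzblock) · p_comp`", Claim 5.16's proof), turning the requirement
  `10 U(T) M^{n-1} ≤ h M^n` of `vxxz2024_prop51_region` into the printed `M ≥ 80 N · V`-type bound.

Everything is proved; the definitions are the counted sets; no named facts.  The product formulas
for `C`, `#{typical pairs}`, `|𝒯α|` (entropy exponents `λ_Z`, `H(γ̄_Z)`, `H(α)`) are not part of
this file.

## References

* V. Vassilevska Williams, Y. Xu, Z. Xu, R. Zhou, *New bounds for matrix multiplication: from alpha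
  to omega*, SODA 2024, arXiv:2307.07970 (held: `paper:arxiv-2307.07970`), Def. 5.13, Claim 5.14 and
  its proof, Claim 5.16 (proof). [VassilevskaWilliamsXuXuZhou2024]
-/

noncomputable section

open scoped BigOperators
open Finset

namespace Literature.Computability.AlgebraicComplexity

/-! ## Equivariance under permutations of the positions -/

section Equivariance

variable {c n : ℕ}

/-- Position classes of a permuted triple. [folklore] -/
theorem mem_posClass_comp {I J K : Fin n → ℕ} (σ : Equiv.Perm (Fin n)) {i j k : ℕ} {t : Fin n} :
    t ∈ posClass (I ∘ σ) (J ∘ σ) (K ∘ σ) i j k ↔ σ t ∈ posClass I J K i j k := by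
  simp [mem_posClass]

/-- Position classes of a permuted triple are the translated position classes. [folklore] -/
theorem posClass_comp (I J K : Fin n → ℕ) (σ : Equiv.Perm (Fin n)) (i j k : ℕ) :
    posClass (I ∘ σ) (J ∘ σ) (K ∘ σ) i j k = (posClass I J K i j k).map σ.symm.toEmbedding := by
  ext t
  rw [mem_posClass_comp, mem_map_equiv]
  simp

/-- `Z`-position classes of a permuted block. [folklore] -/
theorem posClassZ_comp (K : Fin n → ℕ) (σ : Equiv.Perm (Fin n)) (k : ℕ) :
    posClassZ (K ∘ σ) k = (posClassZ K k).map σ.symm.toEmbedding := by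
  ext t
  rw [mem_map_equiv]
  simp [posClassZ]

/-- **Complete split distributions are invariant under permuting the positions.** [cite: VassilevskaWilliamsXuXuZhou2024, Def. 3.5] -/
theorem completeSplitOn_comp (Kh : Fin n → Fin c → Fin 3) (σ : Equiv.Perm (Fin n)) (S : Finset (Fin n)) :
    completeSplitOn (Kh ∘ σ) (S.map σ.symm.toEmbedding) = completeSplitOn Kh S := by
  funext τ
  have h1 : ((S.map σ.symm.toEmbedding).filter fun u => (Kh ∘ σ) u = τ) =
      (S.filter fun u => Kh u = τ).map σ.symm.toEmbedding := by
    ext t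
    simp only [mem_filter, mem_map_equiv, Function.comp_apply, Equiv.symm_symm]
  simp only [completeSplitOn, h1, card_map]

/-- Usefulness is invariant under permuting the positions. [cite: VassilevskaWilliamsXuXuZhou2024, Def. 5.10] -/
theorem isUsefulFor_comp_iff (γ : ℕ × ℕ × ℕ → (Fin c → Fin 3) → ℝ) (I J K : Fin n → ℕ)
    (Kh : Fin n → Fin c → Fin 3) (σ : Equiv.Perm (Fin n)) :
    IsUsefulFor γ (I ∘ σ) (J ∘ σ) (K ∘ σ) (Kh ∘ σ) ↔ IsUsefulFor γ I J K Kh := by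
  simp only [IsUsefulFor, posClass_comp, completeSplitOn_comp, map_nonempty]

/-- Typicalness is invariant under permuting the positions. [cite: VassilevskaWilliamsXuXuZhou2024, Def. 5.12] -/
theorem isTypical_comp_iff (α : ℕ × ℕ × ℕ → ℝ) (γ : ℕ × ℕ × ℕ → (Fin c → Fin 3) → ℝ) (K : Fin n → ℕ)
    (Kh : Fin n → Fin c → Fin 3) (σ : Equiv.Perm (Fin n)) :
    IsTypical c α γ (K ∘ σ) (Kh ∘ σ) ↔ IsTypical c α γ K Kh := by
  simp only [IsTypical, posClassZ_comp, completeSplitOn_comp, map_nonempty]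

/-- Compatibility is invariant under permuting the positions. [cite: VassilevskaWilliamsXuXuZhou2024, Def. 5.8] -/
theorem isCompatibleWith_comp_iff (α : ℕ × ℕ × ℕ → ℝ) (γ : ℕ × ℕ × ℕ → (Fin c → Fin 3) → ℝ)
    (I J K : Fin n → ℕ) (Kh : Fin n → Fin c → Fin 3) (σ : Equiv.Perm (Fin n)) :
    IsCompatibleWith c α γ (I ∘ σ) (J ∘ σ) (K ∘ σ) (Kh ∘ σ) ↔ IsCompatibleWith c α γ I J K Kh := by
  simp only [IsCompatibleWith, posClass_comp, completeSplitOn_comp, map_nonempty, isTypical_comp_iff]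

/-- `α`-consistency is invariant under permuting the positions. [cite: VassilevskaWilliamsXuXuZhou2024, §5.2] -/
theorem isAlphaConsistent_comp_iff (α : ℕ × ℕ × ℕ → ℝ) (I J K : Fin n → ℕ) (σ : Equiv.Perm (Fin n)) :
    IsAlphaConsistent α (I ∘ σ) (J ∘ σ) (K ∘ σ) ↔ IsAlphaConsistent α I J K := by
  simp only [IsAlphaConsistent, posClass_comp, card_map]

/-- The simultaneous action of `S_n` on block triples (precomposition). [folklore] -/
abbrev permT (σ : Equiv.Perm (Fin n))
    (T : (Fin n → Fin (2 * c + 1)) × (Fin n → Fin (2 * c + 1)) × (Fin n → Fin (2 * c + 1))) :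
    (Fin n → Fin (2 * c + 1)) × (Fin n → Fin (2 * c + 1)) × (Fin n → Fin (2 * c + 1)) :=
  (T.1 ∘ σ, T.2.1 ∘ σ, T.2.2 ∘ σ)

/-- `permT` is a left action up to inversion: `permT τ (permT σ T) = permT (σ * τ) T`. [folklore] -/
theorem permT_permT (σ τ : Equiv.Perm (Fin n))
    (T : (Fin n → Fin (2 * c + 1)) × (Fin n → Fin (2 * c + 1)) × (Fin n → Fin (2 * c + 1))) :
    permT τ (permT σ T) = permT (σ * τ) T := rfl

/-- `permT 1 = id`. [folklore] -/
theorem permT_one (T : (Fin n → Fin (2 * c + 1)) × (Fin n → Fin (2 * c + 1)) × (Fin n → Fin (2 * c + 1))) :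
    permT 1 T = T := rfl

/-- A joint type class is stable under `S_n`. [folklore] -/
theorem perm_mem_jointTypeClass {Q : Fin (2 * c + 1) × Fin (2 * c + 1) × Fin (2 * c + 1) → ℕ}
    (σ : Equiv.Perm (Fin n))
    {T : (Fin n → Fin (2 * c + 1)) × (Fin n → Fin (2 * c + 1)) × (Fin n → Fin (2 * c + 1))}
    (hT : T ∈ jointTypeClass n Q) : permT σ T ∈ jointTypeClass n Q := by
  rw [mem_filter] at hT ⊢
  refine ⟨mem_univ _, ?_⟩
  rw [← hT.2]
  exact letterCount_comp_perm (labelSeq T) σ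

/-- `S_n` is transitive on a joint type class. [folklore] -/
theorem exists_perm_of_mem_jointTypeClass {Q : Fin (2 * c + 1) × Fin (2 * c + 1) × Fin (2 * c + 1) → ℕ}
    {T T' : (Fin n → Fin (2 * c + 1)) × (Fin n → Fin (2 * c + 1)) × (Fin n → Fin (2 * c + 1))}
    (hT : T ∈ jointTypeClass n Q) (hT' : T' ∈ jointTypeClass n Q) : ∃ σ : Equiv.Perm (Fin n), permT σ T = T' := by
  have h : letterCount (labelSeq T') = letterCount (labelSeq T) :=
    ((mem_filter.1 hT').2).trans ((mem_filter.1 hT).2).symm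
  obtain ⟨σ, hσ⟩ := exists_perm_of_letterCount_eq h
  -- `hσ : ∀ m, labelSeq T (σ m) = labelSeq T' m`
  refine ⟨σ, ?_⟩
  have h1 : ∀ m, T.1 (σ m) = T'.1 m := fun m => congrArg Prod.fst (hσ m)
  have h2 : ∀ m, T.2.1 (σ m) = T'.2.1 m := fun m => congrArg (fun p => p.2.1) (hσ m)
  have h3 : ∀ m, T.2.2 (σ m) = T'.2.2 m := fun m => congrArg (fun p => p.2.2) (hσ m)
  exact Prod.ext (funext h1) (Prod.ext (funext h2) (funext h3))

end Equivariance

/-! ## The counts of Def. 5.13 / Claim 5.14 -/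

namespace GlobalStageData

open scoped Classical

variable {c n M : ℕ} (D : GlobalStageData c n M)

/-- **`C(T)`**: the number of level-1 `Z`-blocks `Z_K̂ ∈ Z_K` compatible with the triple `T = X_I Y_J Z_K`
(quantity (1) of Claim 5.14's proof, per triple). [cite: VassilevskaWilliamsXuXuZhou2024, Claim 5.14 (proof)] -/
def compatCount (T : (Fin n → Fin (2 * c + 1)) × (Fin n → Fin (2 * c + 1)) × (Fin n → Fin (2 * c + 1))) : ℕ :=
  (univ.filter fun Kh : Fin n → Fin c → Fin 3 => blockOfSeq Kh = T.2.2 ∧ D.Compatible T Kh).card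

/-- The word of pairs `t ↦ (K_t, K̂_t)` of a level-`ℓ` block and a level-1 block. [folklore] -/
def pairSeq (K : Fin n → Fin (2 * c + 1)) (Kh : Fin n → Fin c → Fin 3) :
    Fin n → Fin (2 * c + 1) × (Fin c → Fin 3) := fun t => (K t, Kh t)

/-- **The typical pairs `(Z_K, Z_K̂)`**: `K` of type `μ_Z`, `Z_K̂ ∈ Z_K`, `K̂` typical (Def. 5.12).
[cite: VassilevskaWilliamsXuXuZhou2024, Def. 5.12–5.13] -/
def typicalPairs : Finset ((Fin n → Fin (2 * c + 1)) × (Fin n → Fin c → Fin 3)) :=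
  univ.filter fun p => letterCount p.1 = D.μZ ∧ blockOfSeq p.2 = p.1 ∧ IsTypical c D.α D.γZ (seqVal p.1) p.2

/-- **The triples of `𝒯α` through `Z_K` compatible with `K̂`** (their number `V(K, K̂)` is
`p_comp · numalpha / numzblock`). [cite: VassilevskaWilliamsXuXuZhou2024, Def. 5.13 and Claim 5.16 (proof)] -/
def compatTriples (K : Fin n → Fin (2 * c + 1)) (Kh : Fin n → Fin c → Fin 3) :
    Finset ((Fin n → Fin (2 * c + 1)) × (Fin n → Fin (2 * c + 1)) × (Fin n → Fin (2 * c + 1))) :=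
  D.𝒯α.filter fun T' => T'.2.2 = K ∧ D.Compatible T' Kh

/-- **The pairs (triple of `𝒯α`, compatible level-1 block in its `Z`-block)** — the set counted twice
in Claim 5.14's proof (quantity (1)). [cite: VassilevskaWilliamsXuXuZhou2024, Claim 5.14 (proof)] -/
def compatPairs : Finset (((Fin n → Fin (2 * c + 1)) × (Fin n → Fin (2 * c + 1)) × (Fin n → Fin (2 * c + 1))) ×
    (Fin n → Fin c → Fin 3)) :=
  (D.𝒯α ×ˢ univ).filter fun p => blockOfSeq p.2 = p.1.2.2 ∧ D.Compatible p.1 p.2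

/-- **The symmetry hypothesis on `𝒯α`**: stable and transitive under `S_n` (true for the set of all
triples of a joint type, `symmetric_of_eq_jointTypeClass`). [cite: VassilevskaWilliamsXuXuZhou2024, Def. 5.13 ("By symmetry")] -/
structure Symmetric : Prop where
  /-- `𝒯α` is stable under permuting the positions -/
  perm_mem : ∀ (σ : Equiv.Perm (Fin n)) (T), T ∈ D.𝒯α → permT σ T ∈ D.𝒯α
  /-- `S_n` acts transitively on `𝒯α` -/
  trans : ∀ T ∈ D.𝒯α, ∀ T' ∈ D.𝒯α, ∃ σ : Equiv.Perm (Fin n), permT σ T = T'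

variable {D}

/-- The set of all triples of a joint type is symmetric. [folklore] -/
theorem symmetric_of_eq_jointTypeClass {Q : Fin (2 * c + 1) × Fin (2 * c + 1) × Fin (2 * c + 1) → ℕ}
    (h : D.𝒯α = jointTypeClass n Q) : D.Symmetric := by
  refine ⟨fun σ T hT => ?_, fun T hT T' hT' => ?_⟩
  · rw [h] at hT ⊢; exact perm_mem_jointTypeClass σ hT
  · rw [h] at hT hT'; exact exists_perm_of_mem_jointTypeClass hT hT'

/-- Compatibility with a permuted triple. [cite: VassilevskaWilliamsXuXuZhou2024, Def. 5.8] -/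
theorem compatible_permT_iff (σ : Equiv.Perm (Fin n))
    (T : (Fin n → Fin (2 * c + 1)) × (Fin n → Fin (2 * c + 1)) × (Fin n → Fin (2 * c + 1)))
    (Kh : Fin n → Fin c → Fin 3) : D.Compatible (permT σ T) (Kh ∘ σ) ↔ D.Compatible T Kh :=
  isCompatibleWith_comp_iff D.α D.γZ (seqVal T.1) (seqVal T.2.1) (seqVal T.2.2) Kh σ

/-- **`C` is `S_n`-invariant.** [cite: VassilevskaWilliamsXuXuZhou2024, Claim 5.14 (proof, "by symmetry")] -/
theorem compatCount_permT (σ : Equiv.Perm (Fin n))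
    (T : (Fin n → Fin (2 * c + 1)) × (Fin n → Fin (2 * c + 1)) × (Fin n → Fin (2 * c + 1))) :
    D.compatCount (permT σ T) = D.compatCount T := by
  unfold compatCount
  symm
  refine Finset.card_equiv (Equiv.arrowCongr σ.symm (Equiv.refl _)) fun Kh => ?_
  simp only [mem_filter, mem_univ, true_and]
  have e : (Equiv.arrowCongr σ.symm (Equiv.refl (Fin c → Fin 3))) Kh = Kh ∘ σ := by
    funext t; simp [Equiv.arrowCongr_apply]
  rw [e, compatible_permT_iff]
  constructor
  · rintro ⟨hb, hc⟩
    exact ⟨by rw [← show (blockOfSeq Kh) ∘ σ = blockOfSeq (Kh ∘ σ) from rfl, hb], hc⟩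
  · rintro ⟨hb, hc⟩
    refine ⟨?_, hc⟩
    have hb' : (blockOfSeq Kh) ∘ σ = T.2.2 ∘ σ := hb
    exact comp_perm_injective σ hb'

/-- **`C` does not depend on the triple of `𝒯α`.** [cite: VassilevskaWilliamsXuXuZhou2024, Claim 5.14 (proof)] -/
theorem compatCount_eq_of_mem (hS : D.Symmetric)
    {T T' : (Fin n → Fin (2 * c + 1)) × (Fin n → Fin (2 * c + 1)) × (Fin n → Fin (2 * c + 1))}
    (hT : T ∈ D.𝒯α) (hT' : T' ∈ D.𝒯α) : D.compatCount T = D.compatCount T' := by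
  obtain ⟨σ, hσ⟩ := hS.trans T hT T' hT'
  rw [← hσ, compatCount_permT]

/-- **A typical pair has a determined joint type**: `#{t | K_t = k, K̂_t = σ} = γ̄_{Z,*,*,k}(σ) · μ_Z(k)`.
[cite: VassilevskaWilliamsXuXuZhou2024, Def. 5.12–5.13 ("By symmetry, this probability is the same for different Z_K̂ and Z_K")] -/
theorem letterCount_pairSeq_of_isTypical {K : Fin n → Fin (2 * c + 1)} (hK : letterCount K = D.μZ)
    {Kh : Fin n → Fin c → Fin 3} (htyp : IsTypical c D.α D.γZ (seqVal K) Kh)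
    (a : Fin (2 * c + 1) × (Fin c → Fin 3)) :
    (letterCount (pairSeq K Kh) a : ℝ) = gammaBarZ c D.α D.γZ a.1 a.2 * D.μZ a.1 := by
  have hS : posClassZ (seqVal K) (a.1 : ℕ) = univ.filter fun t => K t = a.1 := by
    ext t; simp [posClassZ, seqVal, Fin.ext_iff]
  have hcardS : (posClassZ (seqVal K) (a.1 : ℕ)).card = D.μZ a.1 := by
    rw [hS, ← hK]; rfl
  have hcount : letterCount (pairSeq K Kh) a = ((posClassZ (seqVal K) (a.1 : ℕ)).filter fun t => Kh t = a.2).card := by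
    rw [letterCount_apply, hS, filter_filter]
    congr 1
    ext t
    simp only [mem_filter, mem_univ, true_and, pairSeq, Prod.ext_iff]
  by_cases h0 : D.μZ a.1 = 0
  · have hempty : posClassZ (seqVal K) (a.1 : ℕ) = ∅ := card_eq_zero.1 (hcardS.trans h0)
    rw [hcount, hempty, filter_empty, card_empty, h0]
    simp
  · have hne : (posClassZ (seqVal K) (a.1 : ℕ)).Nonempty :=
      card_pos.1 (by rw [hcardS]; exact Nat.pos_of_ne_zero h0)
    have h := congrFun (htyp a.1 hne) a.2
    simp only [completeSplitOn] at h
    rw [hcardS] at h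
    have hμ : (D.μZ a.1 : ℝ) ≠ 0 := by exact_mod_cast h0
    rw [div_eq_iff hμ] at h
    rw [hcount, h]

/-- Any two typical pairs have the same joint type. [cite: VassilevskaWilliamsXuXuZhou2024, Def. 5.13] -/
theorem letterCount_pairSeq_eq_of_mem_typicalPairs {p p' : (Fin n → Fin (2 * c + 1)) × (Fin n → Fin c → Fin 3)}
    (hp : p ∈ D.typicalPairs) (hp' : p' ∈ D.typicalPairs) :
    letterCount (pairSeq p.1 p.2) = letterCount (pairSeq p'.1 p'.2) := by
  obtain ⟨-, hK, -, ht⟩ := mem_filter.1 hp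
  obtain ⟨-, hK', -, ht'⟩ := mem_filter.1 hp'
  funext a
  exact_mod_cast (letterCount_pairSeq_of_isTypical hK ht a).trans (letterCount_pairSeq_of_isTypical hK' ht' a).symm

/-- The fibre of the pair set over the word of `(K, K̂)` is the set of compatible triples through `Z_K`.
[cite: VassilevskaWilliamsXuXuZhou2024, Claim 5.14 (proof)] -/
theorem card_filter_compatPairs_eq {K : Fin n → Fin (2 * c + 1)} {Kh : Fin n → Fin c → Fin 3}
    (hKh : blockOfSeq Kh = K) :
    (D.compatPairs.filter fun q => pairSeq q.1.2.2 q.2 = pairSeq K Kh).card = (D.compatTriples K Kh).card := by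
  refine card_bij (fun q _ => q.1) (fun q hq => ?_) (fun q₁ h₁ q₂ h₂ heq => ?_) (fun T' hT' => ?_)
  · obtain ⟨hq, hw⟩ := mem_filter.1 hq
    obtain ⟨hq𝒯, hb, hc⟩ := mem_filter.1 hq
    have h1 : q.1.2.2 = K := funext fun t => congrArg Prod.fst (congrFun hw t)
    have h2 : q.2 = Kh := funext fun t => congrArg Prod.snd (congrFun hw t)
    exact mem_filter.2 ⟨(mem_product.1 hq𝒯).1, h1, h2 ▸ hc⟩
  · obtain ⟨-, hw₁⟩ := mem_filter.1 h₁
    obtain ⟨-, hw₂⟩ := mem_filter.1 h₂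
    have h1 : q₁.2 = Kh := funext fun t => congrArg Prod.snd (congrFun hw₁ t)
    have h2 : q₂.2 = Kh := funext fun t => congrArg Prod.snd (congrFun hw₂ t)
    exact Prod.ext heq (h1.trans h2.symm)
  · obtain ⟨hT'α, hK, hc⟩ := mem_filter.1 hT'
    refine ⟨(T', Kh), mem_filter.2 ⟨mem_filter.2 ⟨mem_product.2 ⟨hT'α, mem_univ _⟩, ?_, hc⟩, ?_⟩, rfl⟩
    · rw [hKh, hK]
    · funext t
      simp only [pairSeq, hK]

/-- **`V(K, K̂)` does not depend on the typical pair** (Def. 5.13 is well posed): the pair set is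
`S_n`-stable with an equivariant projection to pair words, and typical pairs have one joint type.
[cite: VassilevskaWilliamsXuXuZhou2024, Def. 5.13 ("so p_comp is well-defined")] -/
theorem card_compatTriples_eq_of_mem (hS : D.Symmetric)
    {p p' : (Fin n → Fin (2 * c + 1)) × (Fin n → Fin c → Fin 3)}
    (hp : p ∈ D.typicalPairs) (hp' : p' ∈ D.typicalPairs) :
    (D.compatTriples p.1 p.2).card = (D.compatTriples p'.1 p'.2).card := by
  have hb : blockOfSeq p.2 = p.1 := (mem_filter.1 hp).2.2.1
  have hb' : blockOfSeq p'.2 = p'.1 := (mem_filter.1 hp').2.2.1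
  rw [← card_filter_compatPairs_eq hb, ← card_filter_compatPairs_eq hb']
  refine card_fibre_eq_of_equivariant D.compatPairs (fun σ q => (permT σ q.1, q.2 ∘ σ))
    (fun q => pairSeq q.1.2.2 q.2) (fun σ q hq => ?_) (fun σ q₁ q₂ h => ?_) (fun σ q => rfl)
    (letterCount_pairSeq_eq_of_mem_typicalPairs hp hp')
  · obtain ⟨hq𝒯, hbq, hc⟩ := mem_filter.1 hq
    refine mem_filter.2 ⟨mem_product.2 ⟨hS.perm_mem σ _ (mem_product.1 hq𝒯).1, mem_univ _⟩, ?_,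
      (compatible_permT_iff σ q.1 q.2).2 hc⟩
    show (blockOfSeq q.2) ∘ σ = q.1.2.2 ∘ σ
    rw [hbq]
  · exact Prod.ext (permTriple_injective σ (congrArg Prod.fst h)) (comp_perm_injective σ (congrArg Prod.snd h))

/-- **Counting the pair set by triples: `|Φ| = |𝒯α| · C`.** [cite: VassilevskaWilliamsXuXuZhou2024, Claim 5.14 (proof, quantity (1))] -/
theorem card_compatPairs_eq_mul_compatCount (hS : D.Symmetric)
    {T₀ : (Fin n → Fin (2 * c + 1)) × (Fin n → Fin (2 * c + 1)) × (Fin n → Fin (2 * c + 1))}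
    (hT₀ : T₀ ∈ D.𝒯α) : D.compatPairs.card = D.𝒯α.card * D.compatCount T₀ := by
  unfold compatPairs
  rw [card_eq_sum_card_fiberwise (f := Prod.fst) (t := D.𝒯α)
    (fun q hq => (mem_product.1 (mem_filter.1 hq).1).1)]
  rw [sum_const_nat (m := D.compatCount T₀) fun T hT => ?_, mul_comm]
  rw [← compatCount_eq_of_mem hS hT hT₀, compatCount]
  refine card_bij (fun q _ => q.2) (fun q hq => ?_) (fun q₁ h₁ q₂ h₂ heq => ?_) (fun Kh hKh => ?_)
  · obtain ⟨hq, hq1⟩ := mem_filter.1 hq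
    obtain ⟨-, hb, hc⟩ := mem_filter.1 hq
    rw [hq1] at hb hc
    exact mem_filter.2 ⟨mem_univ _, hb, hc⟩
  · exact Prod.ext (((mem_filter.1 h₁).2).trans ((mem_filter.1 h₂).2).symm) heq
  · obtain ⟨-, hb, hc⟩ := mem_filter.1 hKh
    exact ⟨(T, Kh), mem_filter.2 ⟨mem_filter.2 ⟨mem_product.2 ⟨hT, mem_univ _⟩, hb, hc⟩, rfl⟩, rfl⟩

/-- **Counting the pair set by typical pairs: `|Φ| = |typeClass n θ| · V`**, `θ` the joint type of the
typical pairs. [cite: VassilevskaWilliamsXuXuZhou2024, Claim 5.14 (proof, quantity (2) and the ratio)] -/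
theorem card_compatPairs_eq_mul_card_compatTriples (hS : D.Symmetric)
    (hμ : ∀ T ∈ D.𝒯α, letterCount T.2.2 = D.μZ)
    {p₀ : (Fin n → Fin (2 * c + 1)) × (Fin n → Fin c → Fin 3)} (hp₀ : p₀ ∈ D.typicalPairs) :
    D.compatPairs.card = (typeClass n (letterCount (pairSeq p₀.1 p₀.2))).card * (D.compatTriples p₀.1 p₀.2).card := by
  have hb₀ : blockOfSeq p₀.2 = p₀.1 := (mem_filter.1 hp₀).2.2.1
  rw [← card_filter_compatPairs_eq hb₀]
  refine card_eq_card_typeClass_mul_card_fibre D.compatPairs (fun σ q => (permT σ q.1, q.2 ∘ σ))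
    (fun q => pairSeq q.1.2.2 q.2) (fun σ q hq => ?_) (fun σ q₁ q₂ h => ?_) (fun σ q => rfl)
    (fun q hq => ?_) rfl
  · obtain ⟨hq𝒯, hbq, hc⟩ := mem_filter.1 hq
    refine mem_filter.2 ⟨mem_product.2 ⟨hS.perm_mem σ _ (mem_product.1 hq𝒯).1, mem_univ _⟩, ?_,
      (compatible_permT_iff σ q.1 q.2).2 hc⟩
    show (blockOfSeq q.2) ∘ σ = q.1.2.2 ∘ σ
    rw [hbq]
  · exact Prod.ext (permTriple_injective σ (congrArg Prod.fst h)) (comp_perm_injective σ (congrArg Prod.snd h))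
  · -- `(K', K̂')` of a pair is typical, hence of type `θ`
    obtain ⟨hq𝒯, hbq, hc⟩ := mem_filter.1 hq
    have hq' : (q.1.2.2, q.2) ∈ D.typicalPairs :=
      mem_filter.2 ⟨mem_univ _, hμ _ (mem_product.1 hq𝒯).1, hbq, hc.2⟩
    exact letterCount_pairSeq_eq_of_mem_typicalPairs hq' hp₀

/-- **VXXZ Claim 5.14 as an exact double count**: `V · |typeClass n θ| = |𝒯α| · C` — "`p_comp` is the
ratio between (1) and (2)" with `(1) = |𝒯α| · C` and `(2) = #{typical pairs} = |typeClass n θ|`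
(`card_typicalPairs_eq`) times `numalpha/numzblock`, i.e. `V = p_comp · numalpha / numzblock`.
[cite: VassilevskaWilliamsXuXuZhou2024, Claim 5.14] -/
theorem vxxz2024_claim514_count (hS : D.Symmetric) (hμ : ∀ T ∈ D.𝒯α, letterCount T.2.2 = D.μZ)
    {T₀ : (Fin n → Fin (2 * c + 1)) × (Fin n → Fin (2 * c + 1)) × (Fin n → Fin (2 * c + 1))}
    (hT₀ : T₀ ∈ D.𝒯α) {p₀ : (Fin n → Fin (2 * c + 1)) × (Fin n → Fin c → Fin 3)} (hp₀ : p₀ ∈ D.typicalPairs) :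
    (D.compatTriples p₀.1 p₀.2).card * (typeClass n (letterCount (pairSeq p₀.1 p₀.2))).card =
      D.𝒯α.card * D.compatCount T₀ := by
  rw [mul_comm, ← card_compatPairs_eq_mul_card_compatTriples hS hμ hp₀,
    card_compatPairs_eq_mul_compatCount hS hT₀]

/-- **The typical pairs are in bijection with the words of their joint type** (so
`#{typical pairs} = binom(n; θ)`; the printed "the number of typical `Z_K̂` is `2^{H(γ̄_Z) A₁ n ± o(n)}`").
[cite: VassilevskaWilliamsXuXuZhou2024, Claim 5.14 (proof, quantity (2))] -/
theorem card_typicalPairs_eq {p₀ : (Fin n → Fin (2 * c + 1)) × (Fin n → Fin c → Fin 3)}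
    (hp₀ : p₀ ∈ D.typicalPairs) :
    D.typicalPairs.card = (typeClass n (letterCount (pairSeq p₀.1 p₀.2))).card := by
  refine card_bij (fun p _ => pairSeq p.1 p.2) (fun p hp => ?_) (fun p₁ _ p₂ _ h => ?_) (fun w hw => ?_)
  · rw [mem_typeClass]
    exact letterCount_pairSeq_eq_of_mem_typicalPairs hp hp₀
  · have h1 : p₁.1 = p₂.1 := funext fun t => congrArg Prod.fst (congrFun h t)
    have h2 : p₁.2 = p₂.2 := funext fun t => congrArg Prod.snd (congrFun h t)
    exact Prod.ext h1 h2
  · rw [mem_typeClass] at hw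
    obtain ⟨σ, hσ⟩ := exists_perm_of_letterCount_eq hw
    -- `hσ : ∀ m, pairSeq p₀.1 p₀.2 (σ m) = w m`
    obtain ⟨-, hK, hb, ht⟩ := mem_filter.1 hp₀
    refine ⟨(p₀.1 ∘ σ, p₀.2 ∘ σ), mem_filter.2 ⟨mem_univ _, ?_, ?_, ?_⟩, ?_⟩
    · rw [letterCount_comp_perm, hK]
    · show (blockOfSeq p₀.2) ∘ σ = p₀.1 ∘ σ
      rw [hb]
    · exact (isTypical_comp_iff D.α D.γZ (seqVal p₀.1) p₀.2 σ).2 ht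
    · funext t
      exact hσ t

/-- **`U(T) ≤ M_Z(T) · V`** (Claim 5.16's proof: "the total number of level-`ℓ` block triples
`X_{I'} Y_{J'} Z_K` that is compatible with `Z_K̂` is `(numalpha/numzblock) · p_comp`" for each of the
`M_Z(T)` useful — hence typical — blocks `K̂`): the hole count of `GlobalStageHoles.lean` is bounded
by the number of useful `Z`-blocks times the common value `V` of `card_compatTriples_eq_of_mem`.
[cite: VassilevskaWilliamsXuXuZhou2024, Claim 5.16 (proof)] -/
theorem card_holePairs_le (hD : D.WellFormed) (hS : D.Symmetric)
    {T : (Fin n → Fin (2 * c + 1)) × (Fin n → Fin (2 * c + 1)) × (Fin n → Fin (2 * c + 1))}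
    (hT : T ∈ D.𝒯α) {p₀ : (Fin n → Fin (2 * c + 1)) × (Fin n → Fin c → Fin 3)} (hp₀ : p₀ ∈ D.typicalPairs) :
    (D.holePairs T).card ≤ D.usefulZCount T * (D.compatTriples p₀.1 p₀.2).card := by
  have hT𝒯 := hD.subset hT
  have hlev := isLevelTriple_of_mem_tripleSet hT𝒯
  have hα := hD.alphaConsistent T hT
  have hμT : letterCount T.2.2 = D.μZ := (mem_typedSupport.1 hT𝒯).2.2.1
  rw [holePairs, card_eq_sum_card_fiberwise (f := Prod.fst)
    (t := univ.filter fun Kh : Fin n → Fin c → Fin 3 => blockOfSeq Kh = T.2.2 ∧ D.UsefulZ T Kh)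
    (fun q hq => by
      obtain ⟨-, hb, hu, -⟩ := mem_filter.1 hq
      exact mem_filter.2 ⟨mem_univ _, hb, hu⟩)]
  rw [usefulZCount]
  refine (sum_le_sum (g := fun _ => (D.compatTriples p₀.1 p₀.2).card) fun Kh hKh => ?_).trans
    (by rw [sum_const, smul_eq_mul])
  obtain ⟨-, hb, hu⟩ := mem_filter.1 hKh
  -- `(K, K̂)` is a typical pair, so its `V` is the common value
  have htyp : IsTypical c D.α D.γZ (seqVal T.2.2) Kh := IsUsefulFor.isTypical hlev hα hu
  have hpair : (T.2.2, Kh) ∈ D.typicalPairs := mem_filter.2 ⟨mem_univ _, hμT, hb, htyp⟩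
  rw [← card_compatTriples_eq_of_mem hS hpair hp₀]
  -- the fibre over `K̂` injects into the compatible triples through `Z_K` by `q ↦ q.2`
  refine card_le_card_of_injOn (fun q => q.2) (fun q hq => ?_) (fun q₁ h₁ q₂ h₂ heq => ?_)
  · rw [mem_coe, mem_filter] at hq
    obtain ⟨hq, hq1⟩ := hq
    obtain ⟨hq𝒯, -, -, -, hK, hc⟩ := mem_filter.1 hq
    rw [mem_coe, compatTriples, mem_filter]
    refine ⟨(mem_product.1 hq𝒯).2, hK, ?_⟩
    rw [← hq1]; exact hc
  · rw [mem_coe, mem_filter] at h₁ h₂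
    exact Prod.ext (h₁.2.trans h₂.2.symm) heq

end GlobalStageData

end Literature.Computability.AlgebraicComplexity
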